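import Mathlib
import HarnessLib
import Literature.Analysis.FluidPDE.TypeIAncientMild
import Summits.NavierStokesRegularity.NavierStokesRegularity.Theses.ExtremalTypeIConstant
import Summits.NavierStokesRegularity.NavierStokesRegularity.Theses.DulacContraction
import Summits.NavierStokesRegularity.NavierStokesRegularity.Theorems.SymmetryModuliCountFarPastLedgerReduction
import Summits.NavierStokesRegularity.NavierStokesRegularity.Theorems.ExtremalTypeIConstantExtremalSpiralSymmetryOfLocalStabiliser
import Summits.NavierStokesRegularity.NavierStokesRegularity.Theorems.ExtremalTypeIConstantExtremalSpiralSymmetryScalingRecurrenceOfCrux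
import Summits.NavierStokesRegularity.NavierStokesRegularity.Theorems.ExtremalTypeIConstantExtremalSpiralSymmetryTargetOfRecurrence

/-!
# Crux `ExtremalSpiralSymmetry` (stmt-NavierStokesRegularity-8215), line `registered` — the NO-SLACK certificates
# and the literal Conjecture-M bridge

Support file (theorems only, `--supports stmt-NavierStokesRegularity-8215`; no definitions, no named facts). Lead c3.

Two kinds of content, both assembled from landed pieces of the line.

**(A) No-slack certificates (one `iff` each, for the planner's `--glue-by` / re-lining).** Write `REC` for the
registered stub `stub_scalingRecurrence` verbatim ("every extremal pair has an exact scaling period modulo a rigid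
motion and a forward time shift"), `X = TypeIAncientLiouville` (route target, stmt-4050) and `W = RDSSLiouvilleInClass`
(crux stmt-8561, the RDSS wall the line's second stub is certified equivalent to, p152941/p153721). Landed so far:
crux ⇒ REC (`stub_scalingRecurrence_of_ExtremalSpiralSymmetry`, p153068, non-vacuous), X ⇒ REC (vacuous),
W ∧ REC ⇒ X and W ∧ REC ⇒ crux (`…_of_scalingRecurrence_of_rdssLiouvilleInClass`, p153260). Here:

* `extremalSpiralSymmetry_iff_scalingRecurrence_of_rdssLiouvilleInClass` — `W → (crux ↔ REC)`;
* `typeIAncientLiouville_iff_scalingRecurrence_of_rdssLiouvilleInClass` — `W → (X ↔ REC)`;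
* `extremalSpiralSymmetry_iff_typeIAncientLiouville_of_rdssLiouvilleInClass` — `W → (crux ↔ X)`:
  MODULO THE SHARED WALL stmt-8561 THIS CRUX IS THE ROUTE TARGET. (Unconditionally only `X → crux` holds, vacuously.)

So the line `registered` has no slack (its cut is `crux ⇔ REC ∧ W` up to the vacuous direction), and any re-lining of
this crux must prove `REC` (it is implied by the crux alone).

**(B) The literal Conjecture-M bridge.** The card's Conjecture M reads "C⋆-minimisers are isolated modulo translations
and rotations, hence scaling-fixed"; as the line card records, forward time shifts `u(· − δ, ·)`, `δ ≥ 0`, must be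
added to the symmetry semigroup (they stay in `A_C` and converge to `u`). In the topology of pointwise convergence on
the open slab (whose basic neighbourhoods are finitely many point conditions; on `A_C` it agrees with local smooth
convergence by KNSS compactness, not needed here) the corrected conjecture is the displayed hypothesis `ISO` of

* `localScalingStabiliser_of_isolatedModSymm` — `ISO` ⇒ every extremal pair has scaling symmetries modulo rigid
  motions and forward time shifts for all factors near `1` (the parabolic rescalings `c u(c²t, cx)` are nontrivial
  elements of `A_C` — `isTypeIAncientMild_nsRescale` — converging pointwise to `u` as `c → 1` by continuity of `u` on
  the open slab, so they enter every basic neighbourhood of `u`);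
* `extremalSpiralSymmetry_of_isolatedModSymm` — `ISO` ⇒ the crux (compose with the landed
  `extremalSpiralSymmetry_of_localScalingStabiliser`, p155658: pinning + closed-subgroup character + chain rule);
* `scalingRecurrence_of_isolatedModSymm` — `ISO` ⇒ REC (through the crux).

This closes, in Lean, the card's informal chain "isolated ⇒ locally unique ⇒ stabiliser meets every factor near 1 ⇒
spiral generator" modulo exactly the isolatedness statement; nothing here asserts `ISO`, `W`, `REC` or `X`.
-/

noncomputable section

-- the summit and its single sub-problem share the name (CONVENTIONS §1), as in every Theorems file
set_option linter.dupNamespace false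

open Set MeasureTheory Filter Topology
open Literature.Analysis.FluidPDE

namespace Summit.NavierStokesRegularity.NavierStokesRegularity.Theorems.ExtremalSpiralSymmetry.Registered

/-! ### (A) No-slack certificates -/

/-- **No slack, I: given the RDSS wall stmt-8561, the crux is EQUIVALENT to its registered recurrence stub.**
`→`: the crux integrates to an exact period (`stub_scalingRecurrence_of_ExtremalSpiralSymmetry`, unconditional);
`←`: recurrence ∧ wall kill every extremal (`extremalSpiralSymmetry_of_scalingRecurrence_of_rdssLiouvilleInClass`).
CONDITIONAL on stmt-8561 (hypothesis). [folklore] -/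
theorem extremalSpiralSymmetry_iff_scalingRecurrence_of_rdssLiouvilleInClass
    (h8561 : _root_.Summit.NavierStokesRegularity.NavierStokesRegularity.Theses.DulacContraction.RDSSLiouvilleInClass) :
    _root_.Summit.NavierStokesRegularity.NavierStokesRegularity.Theses.ExtremalTypeIConstant.ExtremalSpiralSymmetry ↔
    (∀ (C : ℝ) (u : ℝ → (EuclideanSpace ℝ (Fin 3)) → (EuclideanSpace ℝ (Fin 3))), 0 < C →
      (ContDiffOn ℝ (⊤ : ℕ∞) (Function.uncurry u) (Set.Iio 0 ×ˢ Set.univ) ∧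
          (∀ t < 0, Literature.Analysis.FluidPDE.VectorCalculus.IsDivFree (u t)) ∧
          (∀ s t : ℝ, s < t → t < 0 → ∀ x, u t x =
            Literature.Analysis.FluidPDE.heatFlow (u s) (t - s) x -
              ∫ τ in Set.Ioo s t, ∫ y,
                Literature.Analysis.FluidPDE.oseenKernel (t - τ) (x - y) (u τ y) (u τ y)) ∧
          Literature.Analysis.FluidPDE.HasTypeITimeDecay C u) ∧
        ‖u (-1) 0‖ = C ∧
        (∀ (C' : ℝ) (u' : ℝ → (EuclideanSpace ℝ (Fin 3)) → (EuclideanSpace ℝ (Fin 3))),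
          (ContDiffOn ℝ (⊤ : ℕ∞) (Function.uncurry u') (Set.Iio 0 ×ˢ Set.univ) ∧
            (∀ t < 0, Literature.Analysis.FluidPDE.VectorCalculus.IsDivFree (u' t)) ∧
            (∀ s t : ℝ, s < t → t < 0 → ∀ x, u' t x =
              Literature.Analysis.FluidPDE.heatFlow (u' s) (t - s) x -
                ∫ τ in Set.Ioo s t, ∫ y,
                  Literature.Analysis.FluidPDE.oseenKernel (t - τ) (x - y) (u' τ y) (u' τ y)) ∧
            Literature.Analysis.FluidPDE.HasTypeITimeDecay C' u') →
          (∃ t < 0, ∃ x, u' t x ≠ 0) → C ≤ C') →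
      ∃ c : ℝ, 0 < c ∧ c ≠ 1 ∧ ∃ (δ : ℝ) (b : (EuclideanSpace ℝ (Fin 3))) (R : (EuclideanSpace ℝ (Fin 3)) ≃ₗᵢ[ℝ] (EuclideanSpace ℝ (Fin 3))), 0 ≤ δ ∧
        ∀ t < 0, ∀ x, c • u (c ^ 2 * t) (c • x) = R (u (t - δ) (R.symm (x - b)))) :=
  ⟨stub_scalingRecurrence_of_ExtremalSpiralSymmetry,
    extremalSpiralSymmetry_of_scalingRecurrence_of_rdssLiouvilleInClass h8561⟩

/-- **No slack, II: given the RDSS wall stmt-8561, the route TARGET is equivalent to the recurrence stub.**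
`→` vacuous (`stub_scalingRecurrence_of_TypeIAncientLiouville`); `←` is
`typeIAncientLiouville_of_scalingRecurrence_of_rdssLiouvilleInClass` (uses `MinimiserExists`, proved).
CONDITIONAL on stmt-8561 (hypothesis). [folklore] -/
theorem typeIAncientLiouville_iff_scalingRecurrence_of_rdssLiouvilleInClass
    (h8561 : _root_.Summit.NavierStokesRegularity.NavierStokesRegularity.Theses.DulacContraction.RDSSLiouvilleInClass) :
    _root_.Summit.NavierStokesRegularity.NavierStokesRegularity.Theses.ExtremalTypeIConstant.TypeIAncientLiouville ↔
    (∀ (C : ℝ) (u : ℝ → (EuclideanSpace ℝ (Fin 3)) → (EuclideanSpace ℝ (Fin 3))), 0 < C →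
      (ContDiffOn ℝ (⊤ : ℕ∞) (Function.uncurry u) (Set.Iio 0 ×ˢ Set.univ) ∧
          (∀ t < 0, Literature.Analysis.FluidPDE.VectorCalculus.IsDivFree (u t)) ∧
          (∀ s t : ℝ, s < t → t < 0 → ∀ x, u t x =
            Literature.Analysis.FluidPDE.heatFlow (u s) (t - s) x -
              ∫ τ in Set.Ioo s t, ∫ y,
                Literature.Analysis.FluidPDE.oseenKernel (t - τ) (x - y) (u τ y) (u τ y)) ∧
          Literature.Analysis.FluidPDE.HasTypeITimeDecay C u) ∧
        ‖u (-1) 0‖ = C ∧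
        (∀ (C' : ℝ) (u' : ℝ → (EuclideanSpace ℝ (Fin 3)) → (EuclideanSpace ℝ (Fin 3))),
          (ContDiffOn ℝ (⊤ : ℕ∞) (Function.uncurry u') (Set.Iio 0 ×ˢ Set.univ) ∧
            (∀ t < 0, Literature.Analysis.FluidPDE.VectorCalculus.IsDivFree (u' t)) ∧
            (∀ s t : ℝ, s < t → t < 0 → ∀ x, u' t x =
              Literature.Analysis.FluidPDE.heatFlow (u' s) (t - s) x -
                ∫ τ in Set.Ioo s t, ∫ y,
                  Literature.Analysis.FluidPDE.oseenKernel (t - τ) (x - y) (u' τ y) (u' τ y)) ∧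
            Literature.Analysis.FluidPDE.HasTypeITimeDecay C' u') →
          (∃ t < 0, ∃ x, u' t x ≠ 0) → C ≤ C') →
      ∃ c : ℝ, 0 < c ∧ c ≠ 1 ∧ ∃ (δ : ℝ) (b : (EuclideanSpace ℝ (Fin 3))) (R : (EuclideanSpace ℝ (Fin 3)) ≃ₗᵢ[ℝ] (EuclideanSpace ℝ (Fin 3))), 0 ≤ δ ∧
        ∀ t < 0, ∀ x, c • u (c ^ 2 * t) (c • x) = R (u (t - δ) (R.symm (x - b)))) :=
  ⟨fun hX => stub_scalingRecurrence_of_TypeIAncientLiouville hX,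
    typeIAncientLiouville_of_scalingRecurrence_of_rdssLiouvilleInClass h8561⟩

/-- **No slack, III: MODULO THE SHARED WALL stmt-8561 THE CRUX IS THE ROUTE TARGET.** Given
`RDSSLiouvilleInClass`, `ExtremalSpiralSymmetry ↔ TypeIAncientLiouville` (both sides are equivalent to the recurrence
stub). Unconditionally only `TypeIAncientLiouville → ExtremalSpiralSymmetry` holds (vacuously). CONDITIONAL on
stmt-8561 (hypothesis). [folklore] -/
theorem extremalSpiralSymmetry_iff_typeIAncientLiouville_of_rdssLiouvilleInClass
    (h8561 : _root_.Summit.NavierStokesRegularity.NavierStokesRegularity.Theses.DulacContraction.RDSSLiouvilleInClass) :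
    _root_.Summit.NavierStokesRegularity.NavierStokesRegularity.Theses.ExtremalTypeIConstant.ExtremalSpiralSymmetry ↔
    _root_.Summit.NavierStokesRegularity.NavierStokesRegularity.Theses.ExtremalTypeIConstant.TypeIAncientLiouville :=
  (extremalSpiralSymmetry_iff_scalingRecurrence_of_rdssLiouvilleInClass h8561).trans
    (typeIAncientLiouville_iff_scalingRecurrence_of_rdssLiouvilleInClass h8561).symm

/-! ### (B) The literal Conjecture-M bridge (isolatedness modulo rigid motions and forward time shifts) -/

/-- **Isolatedness gives the local scaling stabiliser.** Suppose (hypothesis `ISO`, the card's Conjecture M corrected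
by forward time shifts, in the pointwise topology): for every extremal pair `(C, u)` there are `ε > 0` and finitely
many slab points `P` such that every NONTRIVIAL `v ∈ A_C` that is `ε`-close to `u` at the points of `P` is a rigid
motion of a forward time shift of `u`. Then every extremal pair has, for all factors `c` near `1`, a scaling symmetry
modulo a rigid motion and a forward time shift — because `c u(c²t, cx)` is a nontrivial element of `A_C` and tends to
`u` pointwise as `c → 1` (continuity of `u` on the open slab). CONDITIONAL on `ISO` (hypothesis). [folklore] -/
theorem localScalingStabiliser_of_isolatedModSymm
    (hiso : ∀ (C : ℝ) (u : ℝ → (EuclideanSpace ℝ (Fin 3)) → (EuclideanSpace ℝ (Fin 3))), 0 < C →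
      (ContDiffOn ℝ (⊤ : ℕ∞) (Function.uncurry u) (Set.Iio 0 ×ˢ Set.univ) ∧
          (∀ t < 0, Literature.Analysis.FluidPDE.VectorCalculus.IsDivFree (u t)) ∧
          (∀ s t : ℝ, s < t → t < 0 → ∀ x, u t x =
            Literature.Analysis.FluidPDE.heatFlow (u s) (t - s) x -
              ∫ τ in Set.Ioo s t, ∫ y,
                Literature.Analysis.FluidPDE.oseenKernel (t - τ) (x - y) (u τ y) (u τ y)) ∧
          Literature.Analysis.FluidPDE.HasTypeITimeDecay C u) ∧
        ‖u (-1) 0‖ = C ∧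
        (∀ (C' : ℝ) (u' : ℝ → (EuclideanSpace ℝ (Fin 3)) → (EuclideanSpace ℝ (Fin 3))),
          (ContDiffOn ℝ (⊤ : ℕ∞) (Function.uncurry u') (Set.Iio 0 ×ˢ Set.univ) ∧
            (∀ t < 0, Literature.Analysis.FluidPDE.VectorCalculus.IsDivFree (u' t)) ∧
            (∀ s t : ℝ, s < t → t < 0 → ∀ x, u' t x =
              Literature.Analysis.FluidPDE.heatFlow (u' s) (t - s) x -
                ∫ τ in Set.Ioo s t, ∫ y,
                  Literature.Analysis.FluidPDE.oseenKernel (t - τ) (x - y) (u' τ y) (u' τ y)) ∧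
            Literature.Analysis.FluidPDE.HasTypeITimeDecay C' u') →
          (∃ t < 0, ∃ x, u' t x ≠ 0) → C ≤ C') →
      ∃ ε : ℝ, 0 < ε ∧ ∃ P : Finset (ℝ × (EuclideanSpace ℝ (Fin 3))), (∀ p ∈ P, p.1 < 0) ∧
        ∀ v : ℝ → (EuclideanSpace ℝ (Fin 3)) → (EuclideanSpace ℝ (Fin 3)), Literature.Analysis.FluidPDE.IsTypeIAncientMild C v → (∃ t < 0, ∃ x, v t x ≠ 0) →
          (∀ p ∈ P, ‖v p.1 p.2 - u p.1 p.2‖ < ε) →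
          ∃ (δ : ℝ) (b : (EuclideanSpace ℝ (Fin 3))) (R : (EuclideanSpace ℝ (Fin 3)) ≃ₗᵢ[ℝ] (EuclideanSpace ℝ (Fin 3))), 0 ≤ δ ∧
            ∀ t < 0, ∀ x, v t x = R (u (t - δ) (R.symm (x - b)))) :
    ∀ (C : ℝ) (u : ℝ → (EuclideanSpace ℝ (Fin 3)) → (EuclideanSpace ℝ (Fin 3))), 0 < C →
      (ContDiffOn ℝ (⊤ : ℕ∞) (Function.uncurry u) (Set.Iio 0 ×ˢ Set.univ) ∧
          (∀ t < 0, Literature.Analysis.FluidPDE.VectorCalculus.IsDivFree (u t)) ∧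
          (∀ s t : ℝ, s < t → t < 0 → ∀ x, u t x =
            Literature.Analysis.FluidPDE.heatFlow (u s) (t - s) x -
              ∫ τ in Set.Ioo s t, ∫ y,
                Literature.Analysis.FluidPDE.oseenKernel (t - τ) (x - y) (u τ y) (u τ y)) ∧
          Literature.Analysis.FluidPDE.HasTypeITimeDecay C u) ∧
        ‖u (-1) 0‖ = C ∧
        (∀ (C' : ℝ) (u' : ℝ → (EuclideanSpace ℝ (Fin 3)) → (EuclideanSpace ℝ (Fin 3))),
          (ContDiffOn ℝ (⊤ : ℕ∞) (Function.uncurry u') (Set.Iio 0 ×ˢ Set.univ) ∧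
            (∀ t < 0, Literature.Analysis.FluidPDE.VectorCalculus.IsDivFree (u' t)) ∧
            (∀ s t : ℝ, s < t → t < 0 → ∀ x, u' t x =
              Literature.Analysis.FluidPDE.heatFlow (u' s) (t - s) x -
                ∫ τ in Set.Ioo s t, ∫ y,
                  Literature.Analysis.FluidPDE.oseenKernel (t - τ) (x - y) (u' τ y) (u' τ y)) ∧
            Literature.Analysis.FluidPDE.HasTypeITimeDecay C' u') →
          (∃ t < 0, ∃ x, u' t x ≠ 0) → C ≤ C') →
      ∃ δ₀ : ℝ, 0 < δ₀ ∧ ∀ c : ℝ, |c - 1| < δ₀ →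
        ∃ (δ : ℝ) (b : (EuclideanSpace ℝ (Fin 3))) (R : (EuclideanSpace ℝ (Fin 3)) ≃ₗᵢ[ℝ] (EuclideanSpace ℝ (Fin 3))), 0 ≤ δ ∧
          ∀ t < 0, ∀ x, c • u (c ^ 2 * t) (c • x) = R (u (t - δ) (R.symm (x - b))) := by
  intro C u hC hext
  obtain ⟨hcls, hnorm, hmin⟩ := hext
  have hA : IsTypeIAncientMild C u := isTypeIAncientMild_iff.2 hcls
  obtain ⟨ε, hε, P, hP, hrig⟩ := hiso C u hC ⟨hcls, hnorm, hmin⟩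
  -- continuity of `c ↦ c • u (c² t, c x)` at `c = 1`, at each of the finitely many test points
  have hcont : ContinuousOn (Function.uncurry u) (Set.Iio 0 ×ˢ Set.univ) := hA.continuousOn_uncurry
  have hpt : ∀ p ∈ P, ∀ᶠ c in 𝓝 (1 : ℝ), ‖c • u (c ^ 2 * p.1) (c • p.2) - u p.1 p.2‖ < ε := by
    intro p hp
    have hopen : IsOpen ((Set.Iio (0 : ℝ)) ×ˢ (Set.univ : Set (EuclideanSpace ℝ (Fin 3)))) := isOpen_Iio.prod isOpen_univ
    have hmem : (p.1, p.2) ∈ (Set.Iio (0 : ℝ)) ×ˢ (Set.univ : Set (EuclideanSpace ℝ (Fin 3))) := ⟨hP p hp, Set.mem_univ _⟩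
    have hAt : ContinuousAt (Function.uncurry u) (p.1, p.2) := hcont.continuousAt (hopen.mem_nhds hmem)
    set g : ℝ → ℝ × (EuclideanSpace ℝ (Fin 3)) := fun c => (c ^ 2 * p.1, c • p.2) with hg
    have hgc : Continuous g := ((continuous_pow 2).mul continuous_const).prodMk (continuous_id.smul continuous_const)
    have hg1 : g 1 = (p.1, p.2) := by simp [hg]
    have hAt' : ContinuousAt (Function.uncurry u) (g 1) := by rw [hg1]; exact hAt
    have hcomp : ContinuousAt (fun c : ℝ => c • Function.uncurry u (g c)) 1 :=
      continuousAt_id.smul (hAt'.comp hgc.continuousAt)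
    have htend := Metric.tendsto_nhds.1 hcomp.tendsto ε hε
    filter_upwards [htend] with c hc
    rw [hg1, one_smul, dist_eq_norm] at hc
    simpa [hg, Function.uncurry] using hc
  have hall : ∀ᶠ c in 𝓝 (1 : ℝ), ∀ p ∈ P, ‖c • u (c ^ 2 * p.1) (c • p.2) - u p.1 p.2‖ < ε :=
    (Filter.eventually_all_finset P).2 hpt
  have hpos : ∀ᶠ c in 𝓝 (1 : ℝ), (0 : ℝ) < c := eventually_gt_nhds one_pos
  obtain ⟨δ₀, hδ₀, hball⟩ := Metric.eventually_nhds_iff.1 (hall.and hpos)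
  refine ⟨δ₀, hδ₀, fun c hc => ?_⟩
  have hc' : dist c 1 < δ₀ := by rwa [Real.dist_eq]
  obtain ⟨hclose, hcpos⟩ := hball hc'
  -- the rescaled field is a nontrivial element of `A_C`, close to `u` at the test points
  have hv : IsTypeIAncientMild C (nsRescale c u) :=
    _root_.Summit.NavierStokesRegularity.NavierStokesRegularity.Theorems.isTypeIAncientMild_nsRescale hA hcpos
  have hc2 : 0 < c ^ 2 := by positivity
  have hvne : ∃ t < 0, ∃ x, nsRescale c u t x ≠ 0 := by
    refine ⟨-(1 / c ^ 2), neg_neg_of_pos (by positivity), 0, ?_⟩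
    have e1 : c ^ 2 * (-(1 / c ^ 2)) = -1 := by field_simp
    have hu0 : u (-1) 0 ≠ 0 := by
      intro h0; rw [h0, norm_zero] at hnorm; exact hC.ne hnorm
    show c • u (c ^ 2 * (-(1 / c ^ 2))) (c • (0 : (EuclideanSpace ℝ (Fin 3)))) ≠ 0
    rw [e1, smul_zero]
    exact smul_ne_zero hcpos.ne' hu0
  have hvclose : ∀ p ∈ P, ‖nsRescale c u p.1 p.2 - u p.1 p.2‖ < ε := fun p hp => hclose p hp
  obtain ⟨δ, b, R, hδ, heq⟩ := hrig (nsRescale c u) hv hvne hvclose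
  exact ⟨δ, b, R, hδ, fun t ht x => heq t ht x⟩

/-- **The crux from Conjecture M (corrected): isolatedness modulo rigid motions and forward time shifts, in the
pointwise topology, implies `ExtremalSpiralSymmetry`.** Compose `localScalingStabiliser_of_isolatedModSymm` with the
landed `extremalSpiralSymmetry_of_localScalingStabiliser` (pinning `δ = 0` by attainment, closed stabiliser, closed-
subgroup character lemma, chain rule). CONDITIONAL on `ISO` (hypothesis). [folklore] -/
theorem extremalSpiralSymmetry_of_isolatedModSymm :
    (∀ (C : ℝ) (u : ℝ → (EuclideanSpace ℝ (Fin 3)) → (EuclideanSpace ℝ (Fin 3))), 0 < C →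
      (ContDiffOn ℝ (⊤ : ℕ∞) (Function.uncurry u) (Set.Iio 0 ×ˢ Set.univ) ∧
          (∀ t < 0, Literature.Analysis.FluidPDE.VectorCalculus.IsDivFree (u t)) ∧
          (∀ s t : ℝ, s < t → t < 0 → ∀ x, u t x =
            Literature.Analysis.FluidPDE.heatFlow (u s) (t - s) x -
              ∫ τ in Set.Ioo s t, ∫ y,
                Literature.Analysis.FluidPDE.oseenKernel (t - τ) (x - y) (u τ y) (u τ y)) ∧
          Literature.Analysis.FluidPDE.HasTypeITimeDecay C u) ∧
        ‖u (-1) 0‖ = C ∧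
        (∀ (C' : ℝ) (u' : ℝ → (EuclideanSpace ℝ (Fin 3)) → (EuclideanSpace ℝ (Fin 3))),
          (ContDiffOn ℝ (⊤ : ℕ∞) (Function.uncurry u') (Set.Iio 0 ×ˢ Set.univ) ∧
            (∀ t < 0, Literature.Analysis.FluidPDE.VectorCalculus.IsDivFree (u' t)) ∧
            (∀ s t : ℝ, s < t → t < 0 → ∀ x, u' t x =
              Literature.Analysis.FluidPDE.heatFlow (u' s) (t - s) x -
                ∫ τ in Set.Ioo s t, ∫ y,
                  Literature.Analysis.FluidPDE.oseenKernel (t - τ) (x - y) (u' τ y) (u' τ y)) ∧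
            Literature.Analysis.FluidPDE.HasTypeITimeDecay C' u') →
          (∃ t < 0, ∃ x, u' t x ≠ 0) → C ≤ C') →
      ∃ ε : ℝ, 0 < ε ∧ ∃ P : Finset (ℝ × (EuclideanSpace ℝ (Fin 3))), (∀ p ∈ P, p.1 < 0) ∧
        ∀ v : ℝ → (EuclideanSpace ℝ (Fin 3)) → (EuclideanSpace ℝ (Fin 3)), Literature.Analysis.FluidPDE.IsTypeIAncientMild C v → (∃ t < 0, ∃ x, v t x ≠ 0) →
          (∀ p ∈ P, ‖v p.1 p.2 - u p.1 p.2‖ < ε) →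
          ∃ (δ : ℝ) (b : (EuclideanSpace ℝ (Fin 3))) (R : (EuclideanSpace ℝ (Fin 3)) ≃ₗᵢ[ℝ] (EuclideanSpace ℝ (Fin 3))), 0 ≤ δ ∧
            ∀ t < 0, ∀ x, v t x = R (u (t - δ) (R.symm (x - b)))) →
    _root_.Summit.NavierStokesRegularity.NavierStokesRegularity.Theses.ExtremalTypeIConstant.ExtremalSpiralSymmetry :=
  fun hiso => extremalSpiralSymmetry_of_localScalingStabiliser (localScalingStabiliser_of_isolatedModSymm hiso)

/-- **Conjecture M (corrected) implies the recurrence stub** — through the crux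
(`stub_scalingRecurrence_of_ExtremalSpiralSymmetry`: the generator integrates to the exact period `c = e`, `δ = 0`).
CONDITIONAL on `ISO` (hypothesis). [folklore] -/
theorem scalingRecurrence_of_isolatedModSymm
    (hiso : ∀ (C : ℝ) (u : ℝ → (EuclideanSpace ℝ (Fin 3)) → (EuclideanSpace ℝ (Fin 3))), 0 < C →
      (ContDiffOn ℝ (⊤ : ℕ∞) (Function.uncurry u) (Set.Iio 0 ×ˢ Set.univ) ∧
          (∀ t < 0, Literature.Analysis.FluidPDE.VectorCalculus.IsDivFree (u t)) ∧
          (∀ s t : ℝ, s < t → t < 0 → ∀ x, u t x =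
            Literature.Analysis.FluidPDE.heatFlow (u s) (t - s) x -
              ∫ τ in Set.Ioo s t, ∫ y,
                Literature.Analysis.FluidPDE.oseenKernel (t - τ) (x - y) (u τ y) (u τ y)) ∧
          Literature.Analysis.FluidPDE.HasTypeITimeDecay C u) ∧
        ‖u (-1) 0‖ = C ∧
        (∀ (C' : ℝ) (u' : ℝ → (EuclideanSpace ℝ (Fin 3)) → (EuclideanSpace ℝ (Fin 3))),
          (ContDiffOn ℝ (⊤ : ℕ∞) (Function.uncurry u') (Set.Iio 0 ×ˢ Set.univ) ∧
            (∀ t < 0, Literature.Analysis.FluidPDE.VectorCalculus.IsDivFree (u' t)) ∧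
            (∀ s t : ℝ, s < t → t < 0 → ∀ x, u' t x =
              Literature.Analysis.FluidPDE.heatFlow (u' s) (t - s) x -
                ∫ τ in Set.Ioo s t, ∫ y,
                  Literature.Analysis.FluidPDE.oseenKernel (t - τ) (x - y) (u' τ y) (u' τ y)) ∧
            Literature.Analysis.FluidPDE.HasTypeITimeDecay C' u') →
          (∃ t < 0, ∃ x, u' t x ≠ 0) → C ≤ C') →
      ∃ ε : ℝ, 0 < ε ∧ ∃ P : Finset (ℝ × (EuclideanSpace ℝ (Fin 3))), (∀ p ∈ P, p.1 < 0) ∧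
        ∀ v : ℝ → (EuclideanSpace ℝ (Fin 3)) → (EuclideanSpace ℝ (Fin 3)), Literature.Analysis.FluidPDE.IsTypeIAncientMild C v → (∃ t < 0, ∃ x, v t x ≠ 0) →
          (∀ p ∈ P, ‖v p.1 p.2 - u p.1 p.2‖ < ε) →
          ∃ (δ : ℝ) (b : (EuclideanSpace ℝ (Fin 3))) (R : (EuclideanSpace ℝ (Fin 3)) ≃ₗᵢ[ℝ] (EuclideanSpace ℝ (Fin 3))), 0 ≤ δ ∧
            ∀ t < 0, ∀ x, v t x = R (u (t - δ) (R.symm (x - b)))) :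
    ∀ (C : ℝ) (u : ℝ → (EuclideanSpace ℝ (Fin 3)) → (EuclideanSpace ℝ (Fin 3))), 0 < C →
      (ContDiffOn ℝ (⊤ : ℕ∞) (Function.uncurry u) (Set.Iio 0 ×ˢ Set.univ) ∧
          (∀ t < 0, Literature.Analysis.FluidPDE.VectorCalculus.IsDivFree (u t)) ∧
          (∀ s t : ℝ, s < t → t < 0 → ∀ x, u t x =
            Literature.Analysis.FluidPDE.heatFlow (u s) (t - s) x -
              ∫ τ in Set.Ioo s t, ∫ y,
                Literature.Analysis.FluidPDE.oseenKernel (t - τ) (x - y) (u τ y) (u τ y)) ∧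
          Literature.Analysis.FluidPDE.HasTypeITimeDecay C u) ∧
        ‖u (-1) 0‖ = C ∧
        (∀ (C' : ℝ) (u' : ℝ → (EuclideanSpace ℝ (Fin 3)) → (EuclideanSpace ℝ (Fin 3))),
          (ContDiffOn ℝ (⊤ : ℕ∞) (Function.uncurry u') (Set.Iio 0 ×ˢ Set.univ) ∧
            (∀ t < 0, Literature.Analysis.FluidPDE.VectorCalculus.IsDivFree (u' t)) ∧
            (∀ s t : ℝ, s < t → t < 0 → ∀ x, u' t x =
              Literature.Analysis.FluidPDE.heatFlow (u' s) (t - s) x -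
                ∫ τ in Set.Ioo s t, ∫ y,
                  Literature.Analysis.FluidPDE.oseenKernel (t - τ) (x - y) (u' τ y) (u' τ y)) ∧
            Literature.Analysis.FluidPDE.HasTypeITimeDecay C' u') →
          (∃ t < 0, ∃ x, u' t x ≠ 0) → C ≤ C') →
      ∃ c : ℝ, 0 < c ∧ c ≠ 1 ∧ ∃ (δ : ℝ) (b : (EuclideanSpace ℝ (Fin 3))) (R : (EuclideanSpace ℝ (Fin 3)) ≃ₗᵢ[ℝ] (EuclideanSpace ℝ (Fin 3))), 0 ≤ δ ∧
        ∀ t < 0, ∀ x, c • u (c ^ 2 * t) (c • x) = R (u (t - δ) (R.symm (x - b))) :=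
  stub_scalingRecurrence_of_ExtremalSpiralSymmetry (extremalSpiralSymmetry_of_isolatedModSymm hiso)

end Summit.NavierStokesRegularity.NavierStokesRegularity.Theorems.ExtremalSpiralSymmetry.Registered

end
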